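import Mathlib
import Literature.Computability.Complexity.CNF
import Literature.Computability.Complexity.PNPWave0
import Literature.Computability.Complexity.RandomKSatLowDegreeHardness

/-!
# Birth skeleton of piece `LinearDegreeSimulation` (BC2 redirect of `SearchHardWindow`, stmt-PneNP-2460)

HONEST SHAPE. The piece says: at every density `α > 0` (all large `k`), frequent polynomial-time
success on `F_k(n, ⌊α n⌋)` is shadowed, for every degree fraction `δ > 0`, by frequent saturated
success of a coordinate-degree-`⌊δ n⌋` map. Its load-bearing instance (the window `α_k`) is the bare
kernel `H(k) ∨ ¬LinearDegreeHardness(k)` (see `shwLD_simulationAt_of_hardAt` in the split glue): no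
lemma of it is smaller than itself there (STRATEGY-CENSUS §1). The only honest cut is therefore BY
DENSITY REGIME, which separates the provable calibration from the open part:

* `stub_simSubcritical` — densities `α < 1/k²` (below the hypergraph giant-component threshold
  `1/(k(k−1))`): the CONSEQUENT holds outright, independently of `f` — an exact, saturated,
  degree-`O(log n) ≤ ⌊δ n⌋` solver exists with success `→ 1` (brute force on the `O(log n)`-size
  components, the isolation indicator `∏_s (1 − [slot s touches the component])` replaced by its
  degree-`C log n` inclusion–exclusion truncation, error `n^{−ω(1)}` per coordinate, values scaled by `2`
  to stay saturated). Size L (new, but elementary random-hypergraph + Bonferroni estimates).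
* `stub_simSupercritical` — densities `α ≥ 1/k²`: OPEN. Contains (i) the giant-component easy regime up
  to `(1−ε_k) 2^k log k/k`, where Bresler–Huang's achievability theorem gives `(η, 0)`-solutions by
  local rules but EXACT saturated simulation of `Fix` (whose matching phase is non-local) is not in
  print; (ii) the band up to the window; (iii) the window instance `= H(k) ∨ ¬LinearDegreeHardness(k)`.

`LinearDegreeSimulation_of` composes them (common threshold in `k`, case split on the density).
Planner planner-cstrat-stmt-PneNP-2460-r1-0, 2026-08-17.
-/

set_option linter.dupNamespace false

noncomputable section

namespace Summit.PneNP.PneNP.Cruxes.SearchHardWindow.LinearDegreeRedirect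

open Finset Filter
open Literature.Computability.Complexity
open scoped Classical

/-- The body of the piece at one `(k, α)`: an energy constant, then for every degree fraction the
shadowing of frequent poly-time success by frequent saturated low-degree success. -/
def SimBody (k : ℕ) (α : ℝ) : Prop :=
  ∃ C : ℝ, 0 < C ∧ ∀ δ : ℝ, 0 < δ → ∀ f : List Bool → List Bool, Literature.Computability.Complexity.IsPolyTime f → ∀ ε : ℝ, 0 < ε → (∃ᶠ n : ℕ in Filter.atTop, ∀ m : ℕ, m = ⌊α * n⌋₊ → ε * Fintype.card (Fin m → Fin k → Fin n × Bool) ≤ ((Finset.univ.filter fun Φ : Fin m → Fin k → Fin n × Bool => ∀ i, ∃ j, (f (Literature.Computability.Complexity.encodingCNF.encode (List.ofFn fun a => List.ofFn fun b => (((Φ a b).1 : ℕ), (Φ a b).2)))).getD (Φ i j).1 false = (Φ i j).2).card : ℝ)) → ∃ F : (n : ℕ) → (m : ℕ) → (Fin m → Fin k → Fin n × Bool) → Fin n → ℝ, (∀ (n m : ℕ) (v : Fin n), Literature.Computability.Complexity.IsCoordDegreeLE ⌊δ * n⌋₊ (fun y : Fin m × Fin k → Fin n × Bool => F n m (Function.curry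 y) v)) ∧ (∀ n m : ℕ, m = ⌊α * n⌋₊ → ∑ Φ : Fin m → Fin k → Fin n × Bool, ∑ v : Fin n, F n m Φ v ^ 2 ≤ C * n * Fintype.card (Fin m → Fin k → Fin n × Bool)) ∧ ∃ᶠ n : ℕ in Filter.atTop, ∀ m : ℕ, m = ⌊α * n⌋₊ → ε / 2 * Fintype.card (Fin m → Fin k → Fin n × Bool) ≤ ((Finset.univ.filter fun Φ : Fin m → Fin k → Fin n × Bool => (∀ v : Fin n, 1 ≤ |F n m Φ v|) ∧ ∀ i : Fin m, ∃ j : Fin k, decide (0 ≤ F n m Φ (Φ i j).1) = (Φ i j).2).card : ℝ)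

/-- The piece, verbatim (as rendered in the route file after the split). -/
def LinearDegreeSimulation : Prop :=
  ∃ k₁ : ℕ, ∀ k ≥ k₁, ∀ α : ℝ, 0 < α → ∃ C : ℝ, 0 < C ∧ ∀ δ : ℝ, 0 < δ → ∀ f : List Bool → List Bool, Literature.Computability.Complexity.IsPolyTime f → ∀ ε : ℝ, 0 < ε → (∃ᶠ n : ℕ in Filter.atTop, ∀ m : ℕ, m = ⌊α * n⌋₊ → ε * Fintype.card (Fin m → Fin k → Fin n × Bool) ≤ ((Finset.univ.filter fun Φ : Fin m → Fin k → Fin n × Bool => ∀ i, ∃ j, (f (Literature.Computability.Complexity.encodingCNF.encode (List.ofFn fun a => List.ofFn fun b => (((Φ a b).1 : ℕ), (Φ a b).2)))).getD (Φ i j).1 false = (Φ i j).2).card : ℝ)) → ∃ F : (n : ℕ) → (m : ℕ) → (Fin m → Fin k → Fin n × Bool) → Fin n → ℝ, (∀ (n m : ℕ) (v : Fin n), Literature.Computability.Complexity.IsCoordDegreeLE ⌊δ * n⌋₊ (fun y : Fin m × Fin k → Fin n × Bool => F n m (Function.curry y) v)) ∧ (∀ n m : ℕ, m = ⌊α * n⌋₊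 → ∑ Φ : Fin m → Fin k → Fin n × Bool, ∑ v : Fin n, F n m Φ v ^ 2 ≤ C * n * Fintype.card (Fin m → Fin k → Fin n × Bool)) ∧ ∃ᶠ n : ℕ in Filter.atTop, ∀ m : ℕ, m = ⌊α * n⌋₊ → ε / 2 * Fintype.card (Fin m → Fin k → Fin n × Bool) ≤ ((Finset.univ.filter fun Φ : Fin m → Fin k → Fin n × Bool => (∀ v : Fin n, 1 ≤ |F n m Φ v|) ∧ ∀ i : Fin m, ∃ j : Fin k, decide (0 ≤ F n m Φ (Φ i j).1) = (Φ i j).2).card : ℝ)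

/-- Stub 1 (size L, provable calibration): the subcritical regime `α < 1/k²`. (The intended proof
shows MORE, f-free: an exact saturated degree-`O(log n)` solver with success `→ 1`.)
[BreslerHuang2022, Thm. 2.13–2.14 (context: local rules are low-degree); folklore (subcritical
random hypergraphs have logarithmic components)] -/
theorem stub_simSubcritical :
    ∃ k₁ : ℕ, ∀ k ≥ k₁, ∀ α : ℝ, 0 < α → α < 1 / (k : ℝ) ^ 2 → SimBody k α := by
  sorry

/-- Stub 2 (OPEN): the supercritical regime `α ≥ 1/k²` — easy giant-component densities (exact
simulation of `Fix` not in print), the band, and the window instance `= H(k) ∨ ¬LinearDegreeHardness(k)`.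
[BreslerHuang2022, §10 (the expectation) and Conj. 2.7; Cojaoghlan2010 (`Fix`)] -/
theorem stub_simSupercritical :
    ∃ k₁ : ℕ, ∀ k ≥ k₁, ∀ α : ℝ, 1 / (k : ℝ) ^ 2 ≤ α → SimBody k α := by
  sorry

/-- **Composition**: common threshold in `k`, case split on the density. -/
theorem LinearDegreeSimulation_of : LinearDegreeSimulation := by
  obtain ⟨k₁, h₁⟩ := stub_simSubcritical
  obtain ⟨k₂, h₂⟩ := stub_simSupercritical
  refine ⟨max k₁ k₂, fun k hk α hα => ?_⟩
  have hk₁ : k₁ ≤ k := (le_max_left _ _).trans hk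
  have hk₂ : k₂ ≤ k := (le_max_right _ _).trans hk
  rcases lt_or_ge α (1 / (k : ℝ) ^ 2) with hlt | hge
  · exact h₁ k hk₁ α hα hlt
  · exact h₂ k hk₂ α hge

end Summit.PneNP.PneNP.Cruxes.SearchHardWindow.LinearDegreeRedirect

end
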